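import Summits.ResolutionOfSingularities.ResolutionOfSingularities.Theorems.ChainW52TargetsF7BetaR
import Literature.AlgebraicGeometry.Resolution.BlowupSequencesAppend
import HarnessLib

/-!
# Crux `PatchingRelPerfect` (stmt-ResolutionOfSingularities-16161), chain W5.2 — F7(β) d = 2 (β-AX) X3: the END TAIL in
# LOCALLY-PRINCIPAL currency — `PhaseCOne P` already yields the principalising tower that T5 consumes

[OURS · L1 W5.2 · F7(β) (β-AX) X3 C-II · res-L1-w52-plan-1 RULING G11-36 (3)(b) «EndTail `phaseCTermination₂_of_phaseCOne`» (named
res-D-pv-021), read against targets v6 `ChainW52TargetsF7BetaR` (G11-46).]  Replaces the role of NO printed item; NOT a statement of the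
manuscript under review; fact-free.  AI-written; AI review is weaker than expert review.  No definitions.

WHAT IS PROVED HERE (and what is not).  `PhaseCOne P` ends with a regular-centre tower `s` over `cosupp S.K`, a factorisation
`S.K·𝒪 = M · S₁.K` (`M` effective Cartier) and a residual END `S₁.residual.IsEndOn U`.  T4 (`IsEndOn.exists_centreSeq`, p543632) run on
`S₁.residual` gives a second regular-centre tower `s₂` over `cosupp K♭ ⊆ s⁻¹ cosupp S.K` with regular top and `K♭·𝒪` LOCALLY PRINCIPAL;
concatenating (`CentreSeq.append`) and multiplying back (`M·𝒪`, the member monomial — res-L1-repro-3's `isLocallyPrincipal_comap_K_of_residual`)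
gives **`exists_principalization_of_phaseCOne`: a regular-centre tower over `cosupp S.K` with regular top along which `S.K` becomes locally
principal** — exactly the datum T5 extracts from `PhaseCTermination₂ P` by E1 + T4 (the composition can consume this theorem in place of
`PhaseCTermination₂ P`).  The literal implication `PhaseCOne P → PhaseCTermination₂ P` additionally asks the transported ideal to be written
`M′ · Sf.K` with `M′` EFFECTIVE CARTIER and `Sf` format-snc END; with the natural witness `Sf := ⊤` this needs the locally principal total
transform of `K♭` to be an effective Cartier divisor (true — the monomial game ends in a monomial of the transformed snc boundary — but not
exported by T4΄s statement); that upgrade is NOT in this file.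

## References
* J. Kollár, *Lectures on Resolution of Singularities* (2007), (3.111) Step 3, Def. 3.29–3.30 (blow-up sequences). [Kollar2007]
* E. Bierstone, D. Grigoriev, P. Milman, J. Włodarczyk (2011), Def. 3.1.3–3.1.5, §4 Step 2b. [BierstoneGrigorievMilmanWlodarczyk2011]
* U. Görtz, T. Wedhorn, *Algebraic Geometry I* (2nd ed., 2020), Prop. 13.91. [GortzWedhorn2020]
-/

-- `Summit.<Summit>.<Sub>.Theorems` with `Sub = Summit` (single-conjunct summit, D-0017)
set_option linter.dupNamespace false

noncomputable section

open CategoryTheory AlgebraicGeometry TopologicalSpace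
open Literature.AlgebraicGeometry.Resolution
open Scheme.IdealSheafData

namespace Summit.ResolutionOfSingularities.ResolutionOfSingularities.Theorems.ChainW52F7BetaR

open DepthMultiHost

universe u

/-- Transport of local principality along the identification `eqToHom` of two (equal) schemes. [folklore] -/
theorem isLocallyPrincipal_comap_eqToHom_comp_iff {X Y Y' : Scheme.{u}} (e : Y = Y') (f : Y' ⟶ X) (K : X.IdealSheafData) :
    IsLocallyPrincipal (K.comap (eqToHom e ≫ f)) ↔ IsLocallyPrincipal (K.comap f) := by
  subst e
  rw [eqToHom_refl, Category.id_comp]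

/-- **END TAIL, locally-principal currency (res-L1-w52-plan-1 RULING G11-36 (3)(b) / targets v6): `PhaseCOne P` ⇒ a regular-centre tower over
`cosupp S.K` with regular top principalising `S.K`.**  Proof: T4 `IsEndOn.exists_centreSeq` on the residual state `S₁.residual` of the
`PhaseCOne` output, `CentreSeq.append`, and the multiply-back `isLocallyPrincipal_comap_K_of_residual` (A8) times the effective Cartier `M`.
[cite: Kollar2007, (3.111) Step 3] [cite: BierstoneGrigorievMilmanWlodarczyk2011, §4 Step 2b] -/
theorem exists_principalization_of_phaseCOne (P : ∀ ⦃X : Scheme.{u}⦄ (S : MultiHostState X), CylState S → Prop)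
    (h : PhaseCOne P) :
    ∀ {X : Scheme.{u}} [IsNoetherian X], Scheme.IsRegular X → Scheme.IsExcellent X →
    ∀ (S : MultiHostState X) (cyl : CylState S) [IsIntegral cyl.Z] [IsNoetherian cyl.Z],
      Scheme.IsRegular cyl.Z → S.n ≠ 0 →
    ∀ (𝓒 : List X.IdealSheafData) (𝓗 : Fin S.n → List (X.IdealSheafData × ℕ)),
      S.IsFormatSncOn cyl.V 𝓒 𝓗 → P S cyl →
      ∃ s : CentreSeq X, s.AllRegular ∧ s.CentresOver (S.K.support : Set X) ∧ Scheme.IsRegular s.top ∧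
        IsLocallyPrincipal (S.K.comap s.comp) := by
  intro X _ hX hXe S cyl _ _ hZ hn 𝓒 𝓗 hfmt hP
  obtain ⟨s, hreg, hover, htop, hN, M, S₁, hK, hM, -, U, hEnd⟩ := h hX hXe S cyl hZ hn 𝓒 𝓗 hfmt hP
  haveI := hN
  -- T4 on the residual state
  obtain ⟨s₂, hreg₂, hover₂, htop₂, hlp⟩ := hEnd.exists_centreSeq htop
  refine ⟨s.append s₂, (CentreSeq.allRegular_append_iff s s₂).mpr ⟨hreg, hreg₂⟩,
    (CentreSeq.centresOver_append_iff s s₂ _).mpr ⟨hover, ?_⟩, ?_, ?_⟩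
  · -- the second tower's centres lie over `cosupp K♭ ⊆ cosupp S₁.K ⊆ cosupp (M · S₁.K) = s⁻¹ cosupp S.K`
    refine CentreSeq.CentresOver.mono s₂ (fun x hx => ?_) hover₂
    have h1 : x ∈ (S₁.K.support : Set s.top) := S₁.residual_K_support_subset hx
    have h2 : x ∈ ((S.K.comap s.comp).support : Set s.top) := by
      rw [hK, Scheme.IdealSheafData.support_mul, Closeds.coe_sup]
      exact Or.inr h1
    rw [Scheme.IdealSheafData.support_comap] at h2
    exact h2
  · rw [CentreSeq.top_append]
    exact htop₂
  · rw [CentreSeq.comp_append, isLocallyPrincipal_comap_eqToHom_comp_iff, Scheme.IdealSheafData.comap_comp, hK, comap_mul]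
    exact (hM.isLocallyPrincipal.comap s₂.comp).mul (S₁.isLocallyPrincipal_comap_K_of_residual s₂.comp hlp)

end Summit.ResolutionOfSingularities.ResolutionOfSingularities.Theorems.ChainW52F7BetaR

end
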